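import Literature.AnabelianGeometry.EtaleTheta.SettingModelSlice2Residual
import HarnessLib

/-!
# (L3′) slice 2, file 5/13 — S6 (splitting over `P_s`) and the axis-pinning devices (★) `D′`-transport of `d_{r,t}`, (★★) two cusps per vertex

Part of the (L3′) slice-2 chain (abc-iut-L6-t19; FILING SHAPE derived from scratch v5 `Slice2TheoremR2ScratchV5.lean`
551b982286441a66 by the edits E1–E4/D1–D3/H1–H2 of FILING-PLAN-SLICE2.md 9643c7e42a42ad24 and the OPTION-L re-cut of §F v1.19gz (W):
one definitions file + twelve theorem files).  Classical profinite group theory about OUR semi-synthetic `F₂hatT`; the objects and laws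
are those of the one-sentence residual of record (cf. [EtTh] §1, §2 for the role they play there — nothing of [EtTh]/[IUTchII]/[IUTchIII]
in print is asserted; no side on [IUTchIII] Cor. 3.12; MORATORIUM (E): no application to `hext_at_iff_exists_f2hatAut_of_eq`).
-/

noncomputable section

open scoped Pointwise

namespace Literature.AnabelianGeometry.EtaleTheta.SettingModel.Slice2

open Literature.AnabelianGeometry.EtaleTheta.SettingModel
open Literature.AnabelianGeometry.EtaleTheta (ZHatLevel.level ZHatLevel.levelChar)
open Literature.AnabelianGeometry.SemiGraphs (GQp)
open Literature.AnabelianGeometry.AbsoluteAnabelian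
open Literature.AnabelianGeometry.AbsoluteAnabelian.AbsTopII
open _root_.Topology

variable {l : ℕ+}

/-! ## §8 (S6 of PL3-R2) SPLITTING: `Ψ′(V_s) ⊆ P_s := a^s Π_v a^{-s}` once the unipotent cocycle is trivial
and `Ψ′` fixes the elements `d_{s,t}` — over the KERNEL fact `Fix(s_{iẐ}) = Π_v`
(`DehnTwist.forall_shearPow_eq_iff_mem_vertGp`) -/

section S6

/-- `s_k(a^s) = (a b^k)^s`. [cite: MochizukiEtTh2009, Prop 1.5 (iii) p.23] -/
theorem shear_aPow (k s : ZH) : shear k (aPow s) = powHat (ea * bPow k) s := by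
  rw [aPow, shear_apply, map_powHat, ← shear_apply, shear_eta_of_zero]

/-- **The S6 operator identity, pointwise**: `D′_t(y) = d_{s,t} · a^s · s_{2t}(a^{-s} y a^s) · a^{-s} · d_{s,t}⁻¹`
for EVERY `y ∈ F̂₂`. [cite: MochizukiEtTh2009, Prop 1.5 (iii) p.23] -/
theorem Dp_eq_conj_dElt (s t : ZH) (y : F₂hatT) :
    Dp t y = dElt s t * (aPow s * shear (t * t) ((aPow s)⁻¹ * y * aPow s) * (aPow s)⁻¹) * (dElt s t)⁻¹ := by
  rw [Dp_apply, innB_apply, map_mul, map_mul, map_inv, shear_aPow, dElt]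
  group

/-- `ĥ_N(a b^{k}) = (1, k̄, k̄)`, hence for `l ∣ k`: `ĥ_l((a b^k)^s a^{-s}) = 1`-ish; we only need membership:
`d_{s,t} ∈ Û_l` for `l ∣ t`. [cite: MochizukiEtTh2009, Def 2.5 (i) p.39] -/
theorem dElt_mem_Uhat {s t : ZH} (ht : ZHatLevel.level l t = 1) : dElt s t ∈ Uhat l := by
  -- `d_{s,t} = D′_t(a^s) · a^{-s}` and `ĥ_l ∘ D′_t = ĥ_l`
  have e : dElt s t = Dp t (aPow s) * bPow t * (aPow s)⁻¹ := by
    rw [Dp_aPow, dElt]; group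
  rw [e, mem_Uhat_iff, map_mul, map_mul, map_inv, hHat_Dp_of_level_eq_one ht, hHat_aPow, hHat_bPow, ht]
  refine ⟨?_, ?_⟩ <;> simp

variable {p : ℕ} [Fact p.Prime] {U₀ : Subgroup (GQp p)} {m : ℕ+} {f' : F₂hatT} {Ψ : F₂hatT → F₂hatT}

/-- **(R2′a) SPLITTING (PL3-R2 S6).** Suppose the unipotent law holds ON THE NOSE (`e_t = 1`, all `t ∈ mẐ`) and
`Ψ′` fixes every `d_{s,t}` (`t ∈ mẐ`). Then for `w ∈ Û_l` with `a^{-s} w a^{s} ∈ Π_v` (i.e. `w ∈ V_s = Û ∩ P_s`),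
also `a^{-s} Ψ′(w) a^{s} ∈ Π_v`: the vertex group `V_s` is mapped INTO `P_s`.  The point (desk): once the axis is
pinned, the `κ`-law identifies each vertex group as the fixed group of an `a^s`-CONJUGATE SHEAR, by the kernel
theorem `Fix(s_{2mẐ}) = Π_v` — no deformation-space rigidity. [cite: MochizukiAbsTopII2013, Prop 1.3 (v) p.12] -/
theorem Residual.conj_psi_mem_vertGp (h : Residual p l U₀ m f' Ψ) (s : ZH)
    (he : ∀ k : ZH, ∀ x ∈ Uhat l, Ψ (Dp (k ^ (m : ℕ)) x) = Dp (k ^ (m : ℕ)) (Ψ x))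
    (hd : ∀ k : ZH, Ψ (dElt s (k ^ (m : ℕ))) = dElt s (k ^ (m : ℕ)))
    {w : F₂hatT} (hwU : w ∈ Uhat l) (hwP : (aPow s)⁻¹ * w * aPow s ∈ DehnTwist.vertGp) :
    (aPow s)⁻¹ * Ψ w * aPow s ∈ DehnTwist.vertGp := by
  have h2m : 0 < 2 * (m : ℕ) := by positivity
  refine (DehnTwist.forall_shearPow_eq_iff_mem_vertGp h2m _).1 fun k => ?_
  rw [DehnTwist.shearPow_apply, pow_mul', pow_two]
  set t : ZH := k ^ (m : ℕ) with ht
  have htl : ZHatLevel.level l t = 1 := level_pow_eq_one_of_dvd h.dvd k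
  have hdU : dElt s t ∈ Uhat l := dElt_mem_Uhat htl
  -- (1) `Ψ′(D′_t w) = d Ψ′(w) d⁻¹` since `D′_t w = d w d⁻¹` on `P_s` and `Ψ′` fixes `d`
  have hfix : shear (t * t) ((aPow s)⁻¹ * w * aPow s) = (aPow s)⁻¹ * w * aPow s := by
    have := (DehnTwist.forall_shearPow_eq_iff_mem_vertGp Nat.one_pos _).2 hwP (t * t)
    rwa [DehnTwist.shearPow_apply, pow_one] at this
  have hDw : Dp t w = dElt s t * w * (dElt s t)⁻¹ := by
    rw [Dp_eq_conj_dElt s t w, hfix]; group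
  have h1 : Ψ (Dp t w) = dElt s t * Ψ w * (dElt s t)⁻¹ := by
    rw [hDw, h.mul _ (mul_mem hdU hwU) _ (inv_mem hdU), h.mul _ hdU _ hwU, h.psi_inv hdU, hd k]
  -- (2) the law: `Ψ′(D′_t w) = D′_t(Ψ′ w) = d · a^s s_{2t}(a^{-s} Ψ′w a^s) a^{-s} · d⁻¹`
  have h2 : Ψ (Dp t w) = dElt s t * (aPow s * shear (t * t) ((aPow s)⁻¹ * Ψ w * aPow s) * (aPow s)⁻¹) *
      (dElt s t)⁻¹ := by
    rw [ht, he k w hwU, ← ht, Dp_eq_conj_dElt s t]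
  -- compare
  have h3 : aPow s * shear (t * t) ((aPow s)⁻¹ * Ψ w * aPow s) * (aPow s)⁻¹ = Ψ w :=
    mul_left_cancel (mul_right_cancel (h2.symm.trans h1))
  calc shear (t * t) ((aPow s)⁻¹ * Ψ w * aPow s)
      = (aPow s)⁻¹ * (aPow s * shear (t * t) ((aPow s)⁻¹ * Ψ w * aPow s) * (aPow s)⁻¹) * aPow s := by group
    _ = (aPow s)⁻¹ * Ψ w * aPow s := by rw [h3]

end S6

/-! ## §9 (S2–S5 of PL3-R2, KERNEL ROUTE) PINNING THE AXIS

Kernel route (this seat; replaces the desk's simultaneous `b`-content bookkeeping with `m_i`, `d_i`, `N_z`):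
(★) for a cusp `y ∈ V_r` with `Ψ′y` on the line `L_s`: `e_t⁻¹ Ψ′(d_{r,t}) ∈ d_{s,t} L_s`;
(★★) the cusps `i` and `i+1` BOTH lie in `V_i`, so `d_{s_i,t}⁻¹ d_{s_{i+1},t} ∈ L_{s_i} L_{s_{i+1}}`, i.e.
`(a b^{2t})^δ a^{-δ} ∈ B β_δ^Ẑ` with `δ = s_i − s_{i+1}`; (W) one wreath-quotient lemma gives `δ ∈ {0, ±1}`;
injectivity of lines (the commuting trick) gives `δ ≠ 0` and a uniform sign. -/

section Axis

variable {p : ℕ} [Fact p.Prime] {l : ℕ+} {U₀ : Subgroup (GQp p)} {m : ℕ+} {f' : F₂hatT} {Ψ : F₂hatT → F₂hatT}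

/-! ### S4: composing with the inversion `σ̂` preserves the residual hypotheses -/

/-- `σ̂` preserves `b`-type. [cite: MochizukiEtTh2009, §2 p.36] -/
theorem isBType_sigmaHat_of {x : F₂hatT} (hx : IsBType x) : IsBType (sigmaHat x) := by
  obtain ⟨g, u, rfl⟩ := hx
  refine ⟨sigmaHat g, u⁻¹, ?_⟩
  rw [map_mul, map_mul, map_inv, sigmaHat_bPow, map_inv bPow]

/-- `σ̂ x` is `b`-type iff `x` is. [cite: MochizukiEtTh2009, §2 p.36] -/
theorem isBType_sigmaHat_iff (x : F₂hatT) : IsBType (sigmaHat x) ↔ IsBType x :=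
  ⟨fun h => by simpa using isBType_sigmaHat_of h, isBType_sigmaHat_of⟩

/-- `σ̂ x ∈ B ↔ x ∈ B`. [cite: MochizukiEtTh2009, §2 p.36] -/
theorem sigmaHat_mem_bAxis_iff (x : F₂hatT) : sigmaHat x ∈ bAxis ↔ x ∈ bAxis := by
  constructor
  · intro h
    obtain ⟨t, ht⟩ := (mem_bAxis_iff _).1 h
    have : x = sigmaHat (bPow t) := by rw [ht, sigmaHat_sigmaHat]
    rw [this, sigmaHat_bPow]
    exact inv_mem (bPow_mem_bAxis t)
  · intro h
    obtain ⟨t, rfl⟩ := (mem_bAxis_iff _).1 h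
    rw [sigmaHat_bPow]
    exact inv_mem (bPow_mem_bAxis t)

/-- **S4 (normalisation device)**: `σ̂ ∘ Ψ′` again satisfies the residual hypotheses, with `f′` replaced by
`σ̂(f′)` (the inversion commutes with every `θ_φ` and every `D′_t`, preserves `Û_l`, `B` and `C`).
[cite: MochizukiEtTh2009, §2 p.36] -/
theorem Residual.sigmaHat_comp (h : Residual p l U₀ m f' Ψ) :
    Residual p l U₀ m (sigmaHat f') (fun x => sigmaHat (Ψ x)) where
  dvd := h.dvd
  mul x hx y hy := by simp only [h.mul x hx y hy, map_mul]
  cont := sigmaHat.continuous.comp h.cont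
  inj x hx y hy hxy := h.inj x hx y hy (by simpa using congrArg sigmaHat hxy)
  mapsTo x hx := by
    rw [← map_inv sigmaHat, ← map_mul, ← map_mul, sigmaHat_mem_Uhat_iff]
    exact h.mapsTo x hx
  torus σ hσ x hx := by simp only [h.torus σ hσ x hx, sigmaHat_twist]
  btype x hx := by rw [isBType_sigmaHat_iff]; exact h.btype x hx
  axis x hx := by rw [sigmaHat_mem_bAxis_iff]; exact h.axis x hx
  dlaw k := by
    obtain ⟨e, he⟩ := h.dlaw k
    refine ⟨sigmaHat e, fun x hx => ?_⟩
    simp only [he x hx, map_mul, map_inv, sigmaHat_Dp]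

/-! ### The image line of an axis cusp -/

/-- `η l` has trivial level `l`. [cite: MochizukiEtTh2009, §1 p.12] -/
theorem level_eta_self (l : ℕ+) : ZHatLevel.level l (ZHatLevel.eta (l : ℤ)) = 1 := by
  rw [ZHatLevel.level_eta, Int.cast_natCast, ZMod.natCast_self, ofAdd_zero]

/-- `b^{η k} = b^k`. [cite: MochizukiEtTh2009, §1 p.12] -/
theorem bPow_eta (k : ℤ) : bPow (ZHatLevel.eta k) = eb ^ k := by
  change bPow (iotaZ (Multiplicative.ofAdd k)) = _
  rw [bPow_iotaZ, toAdd_ofAdd]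

/-- `b^k ≠ 1` for `k ≠ 0` (the free profinite group is torsion-free on `b`: degrees on the `b`-axis).
[cite: MochizukiEtTh2009, §1 p.12] -/
theorem bPow_eta_ne_one {k : ℤ} (hk : k ≠ 0) : bPow (ZHatLevel.eta k) ≠ 1 := by
  rw [Ne, bPow_eq_one_iff]
  intro h
  have := congrArg (ZHatLevel.level ⟨k.natAbs + 1, Nat.succ_pos _⟩) h
  rw [ZHatLevel.level_eta, map_one] at this
  have h2 : ((k : ZMod (k.natAbs + 1)) : ZMod (k.natAbs + 1)) = 0 := ofAdd_eq_one.mp this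
  rw [ZMod.intCast_zmod_eq_zero_iff_dvd] at h2
  refine hk (Int.eq_zero_of_dvd_of_natAbs_lt_natAbs h2 ?_)
  rw [Int.natAbs_natCast]
  exact Nat.lt_succ_self _

/-- The standard cusp `κ_i := β_i^l` lies in `Û_l` and is non-trivial. [cite: MochizukiEtTh2009, §1 p.12] -/
theorem kappa_mem_Uhat (i : ℤ) : betaPow (ZHatLevel.eta i) (ZHatLevel.eta (l : ℤ)) ∈ Uhat l :=
  betaPow_mem_Uhat_of_level_eq_one _ (level_eta_self l)

/-- [cite: MochizukiEtTh2009, §1 p.12] -/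
theorem bPow_eta_l_ne_one (l : ℕ+) : bPow (ZHatLevel.eta (l : ℤ)) ≠ 1 :=
  bPow_eta_ne_one (by exact_mod_cast l.ne_zero)

/-- **THE IMAGE LINE `s(i)` OF THE AXIS CUSP `i`** exists and does not depend on the cusp element: every
non-trivial `β_i^u ∈ Û_l` is mapped by `Ψ′` onto the SAME line `L_{s}` (images of commuting elements commute;
commuting non-trivial `b`-type elements share a line). [cite: MochizukiEtTh2009, §1 p.12] -/
theorem Residual.exists_line (h : Residual p l U₀ m f' Ψ) [U₀.FiniteIndex] (i : ℤ) :
    ∃ s : ZH, ∀ u : ZH, betaPow (ZHatLevel.eta i) u ∈ Uhat l → bPow u ≠ 1 →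
      ∃ μ : ZH, Ψ (betaPow (ZHatLevel.eta i) u) = betaPow s μ ∧ bPow μ ≠ 1 := by
  obtain ⟨s, μ₀, hs, hμ₀⟩ := h.exists_psi_betaPow (kappa_mem_Uhat i) (bPow_eta_l_ne_one l)
  refine ⟨s, fun u hu hne => ?_⟩
  obtain ⟨s', μ, hs', hμ⟩ := h.exists_psi_betaPow hu hne
  have hc : betaPow s' μ * betaPow s μ₀ = betaPow s μ₀ * betaPow s' μ := by
    rw [← hs, ← hs', h.commute_iff hu (kappa_mem_Uhat i)]
    exact betaPow_comm _ _ _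
  exact ⟨μ, (eq_of_betaPow_commute hμ hμ₀ hc) ▸ hs', hμ⟩

/-- `s(i)`: the image line of the axis cusp `i` (a choice; characterised by `Residual.psi_cusp`).
[cite: MochizukiEtTh2009, §1 p.12] -/
def Residual.line (h : Residual p l U₀ m f' Ψ) [U₀.FiniteIndex] (i : ℤ) : ZH :=
  Classical.choose (h.exists_line i)

/-- `Ψ′(β_i^u) = β_{s(i)}^μ` with `b^μ ≠ 1`, for every non-trivial `β_i^u ∈ Û_l`. [cite: MochizukiEtTh2009, §1 p.12] -/
theorem Residual.psi_cusp (h : Residual p l U₀ m f' Ψ) [U₀.FiniteIndex] (i : ℤ) {u : ZH}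
    (hu : betaPow (ZHatLevel.eta i) u ∈ Uhat l) (hne : bPow u ≠ 1) :
    ∃ μ : ZH, Ψ (betaPow (ZHatLevel.eta i) u) = betaPow (h.line i) μ ∧ bPow μ ≠ 1 :=
  Classical.choose_spec (h.exists_line i) u hu hne

/-- `s(0) = 0`: the line `B` is mapped to itself ((B)). [cite: MochizukiEtTh2009, §1 p.12] -/
theorem Residual.line_zero (h : Residual p l U₀ m f' Ψ) [U₀.FiniteIndex] : h.line 0 = 1 := by
  obtain ⟨μ, hμ, hne⟩ := h.psi_cusp 0 (kappa_mem_Uhat 0) (bPow_eta_l_ne_one l)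
  have hB : Ψ (betaPow (ZHatLevel.eta 0) (ZHatLevel.eta (l : ℤ))) ∈ bAxis := by
    refine (h.axis _ (kappa_mem_Uhat 0)).1 ?_
    rw [show ZHatLevel.eta 0 = (1 : ZH) by rw [ZHatLevel.eta_eq_zpow, zpow_zero], betaPow_zero]
    exact bPow_mem_bAxis _
  rw [hμ] at hB
  have := mem_bAxis_of_conj_bPow_mem hne hB
  rwa [aPow_mem_bAxis_iff] at this

/-- **Injectivity of lines**: `s(i) = s(j) → i = j` (non-commuting cusps have non-commuting images).
[cite: MochizukiEtTh2009, §1 p.12] -/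
theorem Residual.line_injective (h : Residual p l U₀ m f' Ψ) [U₀.FiniteIndex] {i j : ℤ}
    (hij : h.line i = h.line j) : i = j := by
  obtain ⟨μ, hμ, hμne⟩ := h.psi_cusp i (kappa_mem_Uhat i) (bPow_eta_l_ne_one l)
  obtain ⟨ν, hν, hνne⟩ := h.psi_cusp j (kappa_mem_Uhat j) (bPow_eta_l_ne_one l)
  have hc : Ψ (betaPow (ZHatLevel.eta i) (ZHatLevel.eta (l : ℤ))) * Ψ (betaPow (ZHatLevel.eta j) (ZHatLevel.eta (l : ℤ)))
      = Ψ (betaPow (ZHatLevel.eta j) (ZHatLevel.eta (l : ℤ))) * Ψ (betaPow (ZHatLevel.eta i) (ZHatLevel.eta (l : ℤ))) := by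
    rw [hμ, hν, hij]; exact betaPow_comm _ _ _
  rw [h.commute_iff (kappa_mem_Uhat i) (kappa_mem_Uhat j)] at hc
  have := eq_of_betaPow_commute (bPow_eta_l_ne_one l) (bPow_eta_l_ne_one l) hc
  -- `η i = η j` ⇒ `i = j`
  have h1 : ZHatLevel.eta (i - j) = 1 := by
    rw [ZHatLevel.eta_eq_zpow, zpow_sub, ← ZHatLevel.eta_eq_zpow, ← ZHatLevel.eta_eq_zpow, this, mul_inv_cancel]
  by_contra hne
  exact bPow_eta_ne_one (sub_ne_zero.mpr hne) (by rw [h1, map_one])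

/-! ### (★): the image of `d_{r,t}` -/

/-- The shear fixes the `a^r`-conjugates of `Π_v` back in `Π_v`: if `a^{-r} y a^{r} ∈ Π_v` then
`D′_t(y) = d_{r,t} y d_{r,t}⁻¹`. [cite: MochizukiAbsTopII2013, Prop 1.3 (v) p.12] -/
theorem Dp_eq_conj_of_mem {r : ZH} {y : F₂hatT} (hy : (aPow r)⁻¹ * y * aPow r ∈ DehnTwist.vertGp) (t : ZH) :
    Dp t y = dElt r t * y * (dElt r t)⁻¹ := by
  have hfix : shear (t * t) ((aPow r)⁻¹ * y * aPow r) = (aPow r)⁻¹ * y * aPow r := by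
    have := (DehnTwist.forall_shearPow_eq_iff_mem_vertGp Nat.one_pos _).2 hy (t * t)
    rwa [DehnTwist.shearPow_apply, pow_one] at this
  rw [Dp_eq_conj_dElt r t y, hfix]; group

/-- `β_r^u ∈ P_r`: `a^{-r} β_r^u a^r = b^u ∈ Π_v`. [cite: MochizukiAbsTopII2013, Prop 1.3 (ii) p.11] -/
theorem conj_betaPow_mem_vertGp (r u : ZH) : (aPow r)⁻¹ * betaPow r u * aPow r ∈ DehnTwist.vertGp := by
  rw [betaPow, show (aPow r)⁻¹ * (aPow r * bPow u * (aPow r)⁻¹) * aPow r = bPow u by group]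
  exact DehnTwist.nodeGp_le_vertGp (bPow_mem_bAxis u)

/-- `β_{r+1}^u ∈ P_r`: `a^{-r} β_{r+1}^u a^r = a b^u a⁻¹ ∈ Π_v`. [cite: MochizukiAbsTopII2013, Prop 1.3 (ii) p.11] -/
theorem conj_betaPow_succ_mem_vertGp (r u : ZH) :
    (aPow r)⁻¹ * betaPow (r * zOne) u * aPow r ∈ DehnTwist.vertGp := by
  rw [betaPow, aPow_mul, aPow_zOne,
    show (aPow r)⁻¹ * (aPow r * ea * bPow u * (aPow r * ea)⁻¹) * aPow r = ea * bPow u * ea⁻¹ by group]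
  refine DehnTwist.conj_nodeGp_le_vertGp ?_
  rw [Subgroup.mem_smul_pointwise_iff_exists]
  exact ⟨bPow u, bPow_mem_bAxis u, rfl⟩

/-- **(★)** For a cusp `y ∈ Û_l ∩ P_r` whose image `Ψ′y = β_s^μ` (`b^μ ≠ 1`) lies on the line `L_s`, and a
unipotent law `Ψ′(D′_t x) = e D′_t(Ψ′x) e⁻¹`: `Ψ′(d_{r,t}) = e · d_{s,t} · β_s^w` for some `w` —
`D′_t` acts as `Inn(d_{r,t})` on `P_r` and as `Inn(d_{s,t})` on `P_s`, and `C_F(β_s^μ) = L_s`.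
[cite: MochizukiEtTh2009, §1 p.12] -/
theorem Residual.exists_psi_dElt (h : Residual p l U₀ m f' Ψ) {r t : ZH} (ht : ZHatLevel.level l t = 1)
    {y : F₂hatT} (hyU : y ∈ Uhat l) (hyP : (aPow r)⁻¹ * y * aPow r ∈ DehnTwist.vertGp)
    {s μ : ZH} (hμ : bPow μ ≠ 1) (hψy : Ψ y = betaPow s μ)
    {e : F₂hatT} (he : ∀ x ∈ Uhat l, Ψ (Dp t x) = e * Dp t (Ψ x) * e⁻¹) :
    ∃ w : ZH, Ψ (dElt r t) = e * dElt s t * betaPow s w := by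
  have hdU : dElt r t ∈ Uhat l := dElt_mem_Uhat ht
  have h1 : Ψ (Dp t y) = Ψ (dElt r t) * betaPow s μ * (Ψ (dElt r t))⁻¹ := by
    rw [Dp_eq_conj_of_mem hyP, h.mul _ (mul_mem hdU hyU) _ (inv_mem hdU), h.mul _ hdU _ hyU, h.psi_inv hdU, hψy]
  have h2 : Ψ (Dp t y) = e * (dElt s t * betaPow s μ * (dElt s t)⁻¹) * e⁻¹ := by
    rw [he y hyU, hψy, Dp_eq_conj_of_mem (conj_betaPow_mem_vertGp s μ)]
  -- `g := (e d_{s,t})⁻¹ Ψ′(d_{r,t})` centralises `β_s^μ`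
  set g := (e * dElt s t)⁻¹ * Ψ (dElt r t) with hg
  have hcomm : g * betaPow s μ * g⁻¹ = betaPow s μ := by
    have e12 := h1.symm.trans h2
    rw [hg, mul_inv_rev]
    calc (dElt s t)⁻¹ * e⁻¹ * Ψ (dElt r t) * betaPow s μ * ((dElt s t)⁻¹ * e⁻¹ * Ψ (dElt r t))⁻¹
        = (dElt s t)⁻¹ * e⁻¹ * (Ψ (dElt r t) * betaPow s μ * (Ψ (dElt r t))⁻¹) * e * dElt s t := by group
      _ = (dElt s t)⁻¹ * e⁻¹ * (e * (dElt s t * betaPow s μ * (dElt s t)⁻¹) * e⁻¹) * e * dElt s t := by rw [e12]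
      _ = betaPow s μ := by group
  -- hence `a^{-s} g a^{s}` commutes with `b^μ`, lies on `B`
  have hB : (aPow s)⁻¹ * g * aPow s ∈ bAxis := by
    apply mem_bAxis_of_commute_bPow hμ
    have hc' : g * (aPow s * bPow μ * (aPow s)⁻¹) * g⁻¹ = aPow s * bPow μ * (aPow s)⁻¹ := hcomm
    calc (aPow s)⁻¹ * g * aPow s * bPow μ
        = (aPow s)⁻¹ * (g * (aPow s * bPow μ * (aPow s)⁻¹) * g⁻¹) * (g * aPow s) := by group
      _ = (aPow s)⁻¹ * (aPow s * bPow μ * (aPow s)⁻¹) * (g * aPow s) := by rw [hc']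
      _ = bPow μ * ((aPow s)⁻¹ * g * aPow s) := by group
  obtain ⟨w, hw⟩ := (mem_bAxis_iff _).1 hB
  refine ⟨w, ?_⟩
  have : Ψ (dElt r t) = e * dElt s t * g := by rw [hg]; group
  rw [this, betaPow, hw]
  group

/-! ### (★★): two cusps in one vertex group -/

/-- `d_{s₂,t}⁻¹ d_{s₁,t} = a^{s₂} (a b^{2t})^{s₁ − s₂} a^{-s₁}`. [cite: MochizukiEtTh2009, §1 p.12] -/
theorem dElt_inv_mul_dElt (s₁ s₂ t : ZH) :
    (dElt s₂ t)⁻¹ * dElt s₁ t = aPow s₂ * powHat (ea * bPow (t * t)) (s₂⁻¹ * s₁) * (aPow s₁)⁻¹ := by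
  rw [dElt, dElt, map_mul (powHat (ea * bPow (t * t))) s₂⁻¹ s₁, map_inv (powHat (ea * bPow (t * t)))]
  group

/-- **(★★) ⇒ the wreath input**: if `d_{s₁,t} β_{s₁}^{w₁} = d_{s₂,t} β_{s₂}^{w₂}` then, with `δ := s₁ − s₂`,
`(a b^{2t})^δ a^{-δ} = b^{w₂} β_δ^{−w₁}`. [cite: MochizukiEtTh2009, §1 p.12] -/
theorem wreath_input_of_dElt_eq {s₁ s₂ t w₁ w₂ : ZH}
    (heq : dElt s₁ t * betaPow s₁ w₁ = dElt s₂ t * betaPow s₂ w₂) :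
    powHat (ea * bPow (t * t)) (s₂⁻¹ * s₁) * (aPow (s₂⁻¹ * s₁))⁻¹ = bPow w₂ * betaPow (s₂⁻¹ * s₁) w₁⁻¹ := by
  have h1 : (dElt s₂ t)⁻¹ * dElt s₁ t = betaPow s₂ w₂ * (betaPow s₁ w₁)⁻¹ := by
    calc (dElt s₂ t)⁻¹ * dElt s₁ t = (dElt s₂ t)⁻¹ * (dElt s₁ t * betaPow s₁ w₁) * (betaPow s₁ w₁)⁻¹ := by group
      _ = (dElt s₂ t)⁻¹ * (dElt s₂ t * betaPow s₂ w₂) * (betaPow s₁ w₁)⁻¹ := by rw [heq]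
      _ = betaPow s₂ w₂ * (betaPow s₁ w₁)⁻¹ := by group
  rw [dElt_inv_mul_dElt, betaPow, betaPow] at h1
  -- cancel `a^{s₂}` on the left and `a^{-s₁}` on the right
  have h2 : powHat (ea * bPow (t * t)) (s₂⁻¹ * s₁) =
      bPow w₂ * (aPow s₂)⁻¹ * aPow s₁ * (bPow w₁)⁻¹ := by
    calc powHat (ea * bPow (t * t)) (s₂⁻¹ * s₁)
        = (aPow s₂)⁻¹ * (aPow s₂ * powHat (ea * bPow (t * t)) (s₂⁻¹ * s₁) * (aPow s₁)⁻¹) * aPow s₁ := by group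
      _ = (aPow s₂)⁻¹ * (aPow s₂ * bPow w₂ * (aPow s₂)⁻¹ * (aPow s₁ * bPow w₁ * (aPow s₁)⁻¹)⁻¹) * aPow s₁ := by
          rw [h1]
      _ = bPow w₂ * (aPow s₂)⁻¹ * aPow s₁ * (bPow w₁)⁻¹ := by group
  rw [h2, betaPow, aPow_mul, aPow_inv, map_inv bPow]
  group

end Axis

end Literature.AnabelianGeometry.EtaleTheta.SettingModel.Slice2

end
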